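import Mathlib.Probability.Moments.Covariance
import Summits.AtomisticToContinuum.HydrodynamicLimit.Theorems.VitaliAmplitudeTransferAmplitudeTransferProbability
import Summits.AtomisticToContinuum.HydrodynamicLimit.Theorems.VitaliAmplitudeTransferAmplitudeTransferWeightIntegrals

/-!
# Amplitude transfer — local Gibbs means are equi-Lipschitz in the amplitude

Step (4) of the Vitali amplitude transfer (route `VitaliAmplitudeTransfer`, item
`AmplitudeTransfer`), concluded: for a one-body empirical observable `W = ∫ w dμ_{Φ_t z}` with
`|w| ≤ C_w (1 + |v|²)` and a path of local Gibbs profiles `s ↦ (a_s, u_s, θ_s)` on `[0,1]` that is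
continuous, with continuous bounded `s`-derivatives on `(0,1)` and within two-sided bounds, the
mean `m_N(s) = E_{ψ_s}[W]` satisfies

* `integral_localGibbsLaw_eq_div` — `E_{ψ_s}[X] = (∫ X F_s) / Z_s`;
* `hasDerivAt_mean` — `m_N'(s) = E[W S] - E[W] E[S] = (N+1) Cov_{ψ_s}(W, Π̄)`, `S = ∑ᵢ π_s(zᵢ)` the
  total score, `Π̄ = S/(N+1)` its empirical average;
* `abs_mean_sub_mean_le` — with CLT-size variance bounds `(N+1) Var W ≤ C_t` and
  `(N+1) Var Π̄ ≤ C₀` (the input from `FieldVarianceBound`), Cauchy–Schwarz gives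
  `|m_N'| ≤ √C_t √C₀`, and the mean value theorem (with continuity at the endpoints) gives
  `|m_N(s) - m_N(s')| ≤ √C_t √C₀ |s - s'|` on `[0,1]`, uniformly in `N`.
-/

noncomputable section

open MeasureTheory ProbabilityTheory Real Filter Set Topology
open scoped InnerProductSpace ENNReal

namespace Summit.AtomisticToContinuum.HydrodynamicLimit.Theorems.AmplitudeTransfer

open Literature.MathematicalPhysics.KineticTheory Literature.Analysis.FluidPDE

variable {σ : ℝ} {N : ℕ}

/-! ### Local Gibbs expectations as ratios -/

/-- **Local Gibbs expectations as ratios**: `E_ψ[X] = Z⁻¹ ∫ X F dz` (any `X`; both sides are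
junk `0` together). -/
theorem integral_localGibbsLaw_eq (Φ : HardSphereFlow (Torus.geometry (Fin 3)) (hsDiameter σ N) (N + 1))
    {a₀ θ₀ : T3 → ℝ} {u₀ : T3 → V3} (ha : Continuous a₀) (hθ : Continuous θ₀) (hu : Continuous u₀)
    (ha0 : ∀ x, 0 ≤ a₀ x) (hθ0 : ∀ x, 0 ≤ θ₀ x) (X : Config (N + 1) (Fin 3) T3 → ℝ) :
    ∫ z, X z ∂(localGibbsLaw σ a₀ u₀ θ₀ N Φ) =
      ((canonicalPartition (Torus.geometry (Fin 3)) (hsDiameter σ N) (N + 1) (localGibbsProfile a₀ u₀ θ₀)))⁻¹ * ∫ z, X z * ((hardSphereDomain (Torus.geometry (Fin 3)) (N + 1) (hsDiameter σ N)).indicator (tensorPow (N + 1) (localGibbsProfile a₀ u₀ θ₀))) z := by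
  rw [localGibbsLaw_eq, localGibbsMeasure]
  rw [integral_withDensity_eq_integral_toReal_smul
    ((measurable_canonicalDensity _ _ (measurable_localGibbsProfile ha hθ hu)).ennreal_ofReal)
    (Eventually.of_forall fun _ => ENNReal.ofReal_lt_top)]
  have hZ : 0 ≤ (canonicalPartition (Torus.geometry (Fin 3)) (hsDiameter σ N) (N + 1) (localGibbsProfile a₀ u₀ θ₀)) :=
    canonicalPartition_nonneg _ _ _ (localGibbsProfile_nonneg ha0 hθ0)
  have hnn : ∀ z, 0 ≤ canonicalDensity (Torus.geometry (Fin 3)) (hsDiameter σ N) (N + 1)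
      (localGibbsProfile a₀ u₀ θ₀) z := fun z =>
    mul_nonneg (inv_nonneg.2 hZ) (Set.indicator_nonneg
      (fun w _ => tensorPow_nonneg (localGibbsProfile_nonneg ha0 hθ0) _ w) z)
  rw [← integral_const_mul]
  refine integral_congr_ae (Eventually.of_forall fun z => ?_)
  dsimp only
  rw [smul_eq_mul, ENNReal.toReal_ofReal (hnn z)]
  simp only [canonicalDensity]
  ring

/-- The partition function is positive when the local Gibbs law is a probability measure. -/
theorem canonicalPartition_pos_of_isProbabilityMeasure
    (Φ : HardSphereFlow (Torus.geometry (Fin 3)) (hsDiameter σ N) (N + 1))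
    {a₀ θ₀ : T3 → ℝ} {u₀ : T3 → V3} (ha0 : ∀ x, 0 ≤ a₀ x) (hθ0 : ∀ x, 0 ≤ θ₀ x)
    [hP : IsProbabilityMeasure (localGibbsLaw σ a₀ u₀ θ₀ N Φ)] : 0 < (canonicalPartition (Torus.geometry (Fin 3)) (hsDiameter σ N) (N + 1) (localGibbsProfile a₀ u₀ θ₀)) := by
  have hZ : 0 ≤ (canonicalPartition (Torus.geometry (Fin 3)) (hsDiameter σ N) (N + 1) (localGibbsProfile a₀ u₀ θ₀)) :=
    canonicalPartition_nonneg _ _ _ (localGibbsProfile_nonneg ha0 hθ0)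
  rcases hZ.lt_or_eq with h | h
  · exact h
  · exfalso
    have h1 := hP.measure_univ
    rw [localGibbsLaw_eq, localGibbsMeasure] at h1
    have hzero : (fun z => ENNReal.ofReal (canonicalDensity (Torus.geometry (Fin 3)) (hsDiameter σ N)
        (N + 1) (localGibbsProfile a₀ u₀ θ₀) z)) = 0 := by
      funext z
      simp [canonicalDensity, ← h]
    rw [hzero, withDensity_zero] at h1
    simp at h1

/-! ### The derivative of the mean in covariance form -/

section Path

variable {a θ : ℝ → T3 → ℝ} {u : ℝ → T3 → V3} {B : ℝ}

/-- **The `s`-derivative of a local Gibbs mean**: at an interior point `s₀` of the path,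
`d/ds E_{ψ_s}[X] = E_{ψ_{s₀}}[X S] - E_{ψ_{s₀}}[X] E_{ψ_{s₀}}[S]` with `S = ∑ᵢ π_{s₀}(zᵢ)` the
total score, for a measurable multiplier `X` with `|X| ≤ C_X (1 + 2E)` a.e. on the domain. -/
theorem hasDerivAt_mean (Φ : HardSphereFlow (Torus.geometry (Fin 3)) (hsDiameter σ N) (N + 1))
    (hB : 1 ≤ B)
    (hcont : ∀ s ∈ Icc (0 : ℝ) 1, Continuous (a s) ∧ Continuous (θ s) ∧ Continuous (u s))
    (hbd : ∀ s ∈ Icc (0 : ℝ) 1, ∀ x,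
      B⁻¹ ≤ a s x ∧ a s x ≤ B ∧ B⁻¹ ≤ θ s x ∧ θ s x ≤ B ∧ ‖u s x‖ ≤ B)
    {sc : ℝ → T3 × V3 → ℝ} {K : ℝ} (hK0 : 0 ≤ K) (hπc : ∀ s ∈ Ioo (0 : ℝ) 1, Continuous (sc s))
    (hπb : ∀ s ∈ Ioo (0 : ℝ) 1, ∀ y, |sc s y| ≤ K * (1 + ‖y.2‖ ^ 2))
    (hπd : ∀ s ∈ Ioo (0 : ℝ) 1, ∀ z : Config (N + 1) (Fin 3) T3,
      HasDerivAt (fun r => ((hardSphereDomain (Torus.geometry (Fin 3)) (N + 1) (hsDiameter σ N)).indicator (tensorPow (N + 1) (localGibbsProfile (a r) (u r) (θ r)))) z) ((∑ i, sc s (z i)) * ((hardSphereDomain (Torus.geometry (Fin 3)) (N + 1) (hsDiameter σ N)).indicator (tensorPow (N + 1) (localGibbsProfile (a s) (u s) (θ s)))) z) s)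
    (hprob : ∀ s ∈ Icc (0 : ℝ) 1, IsProbabilityMeasure (localGibbsLaw σ (a s) (u s) (θ s) N Φ))
    {X : Config (N + 1) (Fin 3) T3 → ℝ} (hXm : Measurable X) {CX : ℝ}
    (hXb : ∀ᵐ z ∂(volume : Measure (Config (N + 1) (Fin 3) T3)), z ∈ (hardSphereDomain (Torus.geometry (Fin 3)) (N + 1) (hsDiameter σ N)) →
      |X z| ≤ CX * (1 + 2 * configEnergy z))
    {s₀ : ℝ} (hs₀ : s₀ ∈ Ioo (0 : ℝ) 1) :
    HasDerivAt (fun s => ∫ z, X z ∂(localGibbsLaw σ (a s) (u s) (θ s) N Φ))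
      ((∫ z, X z * (∑ i, sc s₀ (z i)) ∂(localGibbsLaw σ (a s₀) (u s₀) (θ s₀) N Φ)) -
        (∫ z, X z ∂(localGibbsLaw σ (a s₀) (u s₀) (θ s₀) N Φ)) *
        (∫ z, (∑ i, sc s₀ (z i)) ∂(localGibbsLaw σ (a s₀) (u s₀) (θ s₀) N Φ))) s₀ := by
  have hB0 : 0 < B := by linarith
  have hsub : Ioo (0 : ℝ) 1 ⊆ Icc 0 1 := Ioo_subset_Icc_self
  have hpos0 : ∀ s ∈ Icc (0 : ℝ) 1, (∀ x, 0 ≤ a s x) ∧ ∀ x, 0 ≤ θ s x := fun s hs =>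
    ⟨fun x => ((inv_pos.2 hB0).le.trans (hbd s hs x).1),
      fun x => ((inv_pos.2 hB0).le.trans (hbd s hs x).2.2.1)⟩
  -- numerator `A`, denominator `Z`, as weighted integrals
  have h1b : ∀ᵐ z ∂(volume : Measure (Config (N + 1) (Fin 3) T3)), z ∈ (hardSphereDomain (Torus.geometry (Fin 3)) (N + 1) (hsDiameter σ N)) →
      |(fun _ => (1 : ℝ)) z| ≤ 1 * (1 + 2 * configEnergy z) :=
    Eventually.of_forall fun z _ => by
      have := configEnergy_nonneg' z
      simp only [abs_one]; nlinarith
  obtain ⟨hA'i, hA⟩ := hasDerivAt_integral_weight (σ := σ) (N := N) hB hcont hbd hK0 hπc hπb hπd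
    hXm hXb hs₀
  obtain ⟨hZ'i, hZ⟩ := hasDerivAt_integral_weight (σ := σ) (N := N) hB hcont hbd hK0 hπc hπb hπd
    (measurable_const (a := (1 : ℝ))) h1b hs₀
  simp only [one_mul] at hZ hZ'i
  -- `Z s = ∫ F_s` is the partition function, positive on `[0,1]`
  have hZeq : ∀ s, (∫ z, ((hardSphereDomain (Torus.geometry (Fin 3)) (N + 1) (hsDiameter σ N)).indicator (tensorPow (N + 1) (localGibbsProfile (a s) (u s) (θ s)))) z) = (canonicalPartition (Torus.geometry (Fin 3)) (hsDiameter σ N) (N + 1) (localGibbsProfile (a s) (u s) (θ s))) := fun s => rfl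
  have hZpos : 0 < (canonicalPartition (Torus.geometry (Fin 3)) (hsDiameter σ N) (N + 1) (localGibbsProfile (a s₀) (u s₀) (θ s₀))) := by
    haveI := hprob s₀ (hsub hs₀)
    exact canonicalPartition_pos_of_isProbabilityMeasure Φ (hpos0 s₀ (hsub hs₀)).1
      (hpos0 s₀ (hsub hs₀)).2
  -- the mean as the ratio `A/Z` near `s₀`
  have hmean : ∀ s ∈ Icc (0 : ℝ) 1, ∀ Y : Config (N + 1) (Fin 3) T3 → ℝ,
      ∫ z, Y z ∂(localGibbsLaw σ (a s) (u s) (θ s) N Φ) =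
        (∫ z, Y z * ((hardSphereDomain (Torus.geometry (Fin 3)) (N + 1) (hsDiameter σ N)).indicator (tensorPow (N + 1) (localGibbsProfile (a s) (u s) (θ s)))) z) / ∫ z, ((hardSphereDomain (Torus.geometry (Fin 3)) (N + 1) (hsDiameter σ N)).indicator (tensorPow (N + 1) (localGibbsProfile (a s) (u s) (θ s)))) z := by
    intro s hs Y
    rw [integral_localGibbsLaw_eq Φ (hcont s hs).1 (hcont s hs).2.1 (hcont s hs).2.2
      (hpos0 s hs).1 (hpos0 s hs).2, hZeq, div_eq_inv_mul]
  have hev : (fun s => ∫ z, X z ∂(localGibbsLaw σ (a s) (u s) (θ s) N Φ)) =ᶠ[𝓝 s₀]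
      fun s => (∫ z, X z * ((hardSphereDomain (Torus.geometry (Fin 3)) (N + 1) (hsDiameter σ N)).indicator (tensorPow (N + 1) (localGibbsProfile (a s) (u s) (θ s)))) z) / ∫ z, ((hardSphereDomain (Torus.geometry (Fin 3)) (N + 1) (hsDiameter σ N)).indicator (tensorPow (N + 1) (localGibbsProfile (a s) (u s) (θ s)))) z := by
    filter_upwards [Ioo_mem_nhds hs₀.1 hs₀.2] with s hs
    exact hmean s (hsub hs) X
  have hdiv := hA.div hZ (by rw [hZeq]; exact hZpos.ne')
  refine (hdiv.congr_of_eventuallyEq hev).congr_deriv ?_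
  -- identification of the derivative
  rw [hmean s₀ (hsub hs₀), hmean s₀ (hsub hs₀), hmean s₀ (hsub hs₀)]
  have hZne : (∫ z, ((hardSphereDomain (Torus.geometry (Fin 3)) (N + 1) (hsDiameter σ N)).indicator (tensorPow (N + 1) (localGibbsProfile (a s₀) (u s₀) (θ s₀)))) z) ≠ 0 := by rw [hZeq]; exact hZpos.ne'
  have hassoc : (∫ z, X z * (∑ i, sc s₀ (z i)) * ((hardSphereDomain (Torus.geometry (Fin 3)) (N + 1) (hsDiameter σ N)).indicator (tensorPow (N + 1) (localGibbsProfile (a s₀) (u s₀) (θ s₀)))) z) =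
      ∫ z, X z * ((∑ i, sc s₀ (z i)) * ((hardSphereDomain (Torus.geometry (Fin 3)) (N + 1) (hsDiameter σ N)).indicator (tensorPow (N + 1) (localGibbsProfile (a s₀) (u s₀) (θ s₀)))) z) := by
    refine integral_congr_ae (Eventually.of_forall fun z => ?_)
    simp only [mul_assoc]
  rw [hassoc]
  generalize (∫ z, X z * ((∑ i, sc s₀ (z i)) * ((hardSphereDomain (Torus.geometry (Fin 3)) (N + 1) (hsDiameter σ N)).indicator (tensorPow (N + 1) (localGibbsProfile (a s₀) (u s₀) (θ s₀)))) z)) = A'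
  generalize (∫ z, X z * ((hardSphereDomain (Torus.geometry (Fin 3)) (N + 1) (hsDiameter σ N)).indicator (tensorPow (N + 1) (localGibbsProfile (a s₀) (u s₀) (θ s₀)))) z) = Av
  generalize (∫ z, (∑ i, sc s₀ (z i)) * ((hardSphereDomain (Torus.geometry (Fin 3)) (N + 1) (hsDiameter σ N)).indicator (tensorPow (N + 1) (localGibbsProfile (a s₀) (u s₀) (θ s₀)))) z) = Z'v
  generalize (∫ z, ((hardSphereDomain (Torus.geometry (Fin 3)) (N + 1) (hsDiameter σ N)).indicator (tensorPow (N + 1) (localGibbsProfile (a s₀) (u s₀) (θ s₀)))) z) = Zv at hZne ⊢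
  field_simp

/-- The local Gibbs laws along the path are absolutely continuous with respect to the Liouville
measure; in particular `Φ_0 = id` almost surely. -/
theorem flow_zero_ae_eq (Φ : HardSphereFlow (Torus.geometry (Fin 3)) (hsDiameter σ N) (N + 1))
    (a₀ θ₀ : T3 → ℝ) (u₀ : T3 → V3) :
    ∀ᵐ z ∂(localGibbsLaw σ a₀ u₀ θ₀ N Φ), Φ.flow 0 z = z := by
  have hgood : ∀ᵐ z ∂(localGibbsLaw σ a₀ u₀ θ₀ N Φ), z ∈ Φ.good := by
    rw [localGibbsLaw_eq]
    exact (localGibbsMeasure_absolutelyContinuous σ a₀ u₀ θ₀ N Φ).ae_le Φ.ae_mem_good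
  filter_upwards [hgood] with z hz
  exact Φ.flow_zero z hz

/-- **Cauchy–Schwarz bound on the derivative of the mean**: `|E[X S] - E[X] E[S]| ≤ √C_t √C₀`
when `(N+1) eVar(X) ≤ C_t` and `(N+1) eVar(Π̄ ∘ Φ_0) ≤ C₀`, where `Π̄ = ∫ π dμ_z = S/(N+1)`. -/
theorem abs_sub_mul_le_sqrt (Φ : HardSphereFlow (Torus.geometry (Fin 3)) (hsDiameter σ N) (N + 1))
    {a₀ θ₀ : T3 → ℝ} {u₀ : T3 → V3} [IsProbabilityMeasure (localGibbsLaw σ a₀ u₀ θ₀ N Φ)]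
    {X : Config (N + 1) (Fin 3) T3 → ℝ} (hXm : Measurable X) {π₀ : T3 × V3 → ℝ} (hπ : Continuous π₀)
    {Ct C0 : ℝ} (hCt : 0 ≤ Ct) (hC0 : 0 ≤ C0)
    (hVX : ((N : ℝ≥0∞) + 1) * evariance X (localGibbsLaw σ a₀ u₀ θ₀ N Φ) ≤ ENNReal.ofReal Ct)
    (hVπ : ((N : ℝ≥0∞) + 1) * evariance (fun z => ∫ y, π₀ y ∂(empiricalMeasure (Φ.flow 0 z)))
      (localGibbsLaw σ a₀ u₀ θ₀ N Φ) ≤ ENNReal.ofReal C0) :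
    |(∫ z, X z * (∑ i, π₀ (z i)) ∂(localGibbsLaw σ a₀ u₀ θ₀ N Φ)) -
        (∫ z, X z ∂(localGibbsLaw σ a₀ u₀ θ₀ N Φ)) * (∫ z, (∑ i, π₀ (z i)) ∂(localGibbsLaw σ a₀ u₀ θ₀ N Φ))|
      ≤ Real.sqrt Ct * Real.sqrt C0 := by
  set P := localGibbsLaw σ a₀ u₀ θ₀ N Φ with hP
  have hN : (0 : ℝ) < (N : ℝ) + 1 := by positivity
  -- the empirical average of the score, `Π̄ = S/(N+1)`, and its a.s. identification with `Π̄ ∘ Φ_0`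
  set Sbar : Config (N + 1) (Fin 3) T3 → ℝ := fun z => ((N + 1 : ℕ) : ℝ)⁻¹ * ∑ i, π₀ (z i) with hSbar
  have hSbar_eq : ∀ z, ∫ y, π₀ y ∂(empiricalMeasure z) = Sbar z := fun z => by
    rw [hSbar, integral_empiricalMeasure]
  have hae : (fun z => ∫ y, π₀ y ∂(empiricalMeasure (Φ.flow 0 z))) =ᵐ[P] Sbar := by
    filter_upwards [flow_zero_ae_eq Φ a₀ θ₀ u₀] with z hz
    rw [hz, hSbar_eq]
  have hSm : Measurable Sbar := measurable_const.mul (measurable_sum_comp hπ)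
  rw [evariance_congr hae] at hVπ
  -- square integrability and real variance bounds
  obtain ⟨hXL, hXv⟩ := memLp_two_and_variance_le_of_evariance_le hXm.aestronglyMeasurable hCt N hVX
  obtain ⟨hSL, hSv⟩ := memLp_two_and_variance_le_of_evariance_le hSm.aestronglyMeasurable hC0 N hVπ
  -- the total score is `(N+1) Π̄`
  have hS_eq : (fun z => ∑ i, π₀ (z i)) = fun z => ((N : ℝ) + 1) * Sbar z := by
    funext z
    rw [hSbar]
    simp only [Nat.cast_add, Nat.cast_one]
    field_simp
  have hXS : (fun z => X z * ∑ i, π₀ (z i)) = fun z => ((N : ℝ) + 1) * (X z * Sbar z) := by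
    funext z
    rw [hSbar]
    simp only [Nat.cast_add, Nat.cast_one]
    field_simp
  rw [hXS, hS_eq, integral_const_mul, integral_const_mul]
  -- covariance identity and Cauchy–Schwarz
  have hcov : cov[X, Sbar; P] = (∫ z, X z * Sbar z ∂P) - (∫ z, X z ∂P) * (∫ z, Sbar z ∂P) := by
    rw [covariance_eq_sub hXL hSL]
    rfl
  have hCS : |cov[X, Sbar; P]| ≤ Real.sqrt (variance X P) * Real.sqrt (variance Sbar P) :=
    abs_integral_sub_mul_sub_le hXL hSL
  have hkey : ((N : ℝ) + 1) * (Real.sqrt (variance X P) * Real.sqrt (variance Sbar P)) ≤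
      Real.sqrt Ct * Real.sqrt C0 := by
    have h1 : Real.sqrt (variance X P) ≤ Real.sqrt Ct / Real.sqrt ((N : ℝ) + 1) := by
      rw [← Real.sqrt_div hCt]; exact Real.sqrt_le_sqrt hXv
    have h2 : Real.sqrt (variance Sbar P) ≤ Real.sqrt C0 / Real.sqrt ((N : ℝ) + 1) := by
      rw [← Real.sqrt_div hC0]; exact Real.sqrt_le_sqrt hSv
    have hsqpos : 0 < Real.sqrt ((N : ℝ) + 1) := Real.sqrt_pos.2 hN
    calc ((N : ℝ) + 1) * (Real.sqrt (variance X P) * Real.sqrt (variance Sbar P))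
        ≤ ((N : ℝ) + 1) * ((Real.sqrt Ct / Real.sqrt ((N : ℝ) + 1)) *
            (Real.sqrt C0 / Real.sqrt ((N : ℝ) + 1))) := by
          exact mul_le_mul_of_nonneg_left (mul_le_mul h1 h2 (Real.sqrt_nonneg _) (by positivity))
            hN.le
      _ = Real.sqrt Ct * Real.sqrt C0 := by
          field_simp
          rw [Real.sq_sqrt hN.le]
          ring
  calc |((N : ℝ) + 1) * ∫ z, X z * Sbar z ∂P - (∫ z, X z ∂P) * (((N : ℝ) + 1) * ∫ z, Sbar z ∂P)|
      = ((N : ℝ) + 1) * |cov[X, Sbar; P]| := by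
        rw [hcov, ← abs_of_pos hN, ← abs_mul, abs_of_pos hN]
        congr 1; ring
    _ ≤ ((N : ℝ) + 1) * (Real.sqrt (variance X P) * Real.sqrt (variance Sbar P)) :=
        mul_le_mul_of_nonneg_left hCS hN.le
    _ ≤ Real.sqrt Ct * Real.sqrt C0 := hkey

/-- **Local Gibbs means are equi-Lipschitz in the amplitude.** For the one-body empirical
observable `W = ∫ w dμ_{Φ_t z}` (`w` continuous, `|w| ≤ C_w (1 + |v|²)`) along a path of profiles
on `[0,1]` (continuous, with continuous bounded `s`-derivatives on `(0,1)`, within two-sided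
bounds, local Gibbs laws probability measures), CLT-size variance bounds for `W` at time `t` and
for the empirical scores `∫ π_s dμ_{Φ_0 z}` at time `0` give
`|E_{ψ_s}[W] - E_{ψ_{s'}}[W]| ≤ √C_t √C₀ |s - s'|` on `[0,1]`. -/
theorem abs_mean_sub_mean_le (Φ : HardSphereFlow (Torus.geometry (Fin 3)) (hsDiameter σ N) (N + 1))
    (hB : 1 ≤ B)
    (hcont : ∀ s ∈ Icc (0 : ℝ) 1, Continuous (a s) ∧ Continuous (θ s) ∧ Continuous (u s))
    (hconts : ∀ x, ContinuousOn (fun s => a s x) (Icc 0 1) ∧ ContinuousOn (fun s => θ s x) (Icc 0 1) ∧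
      ContinuousOn (fun s => u s x) (Icc 0 1))
    (hbd : ∀ s ∈ Icc (0 : ℝ) 1, ∀ x,
      B⁻¹ ≤ a s x ∧ a s x ≤ B ∧ B⁻¹ ≤ θ s x ∧ θ s x ≤ B ∧ ‖u s x‖ ≤ B)
    {sc : ℝ → T3 × V3 → ℝ} {K : ℝ} (hK0 : 0 ≤ K) (hπc : ∀ s ∈ Ioo (0 : ℝ) 1, Continuous (sc s))
    (hπb : ∀ s ∈ Ioo (0 : ℝ) 1, ∀ y, |sc s y| ≤ K * (1 + ‖y.2‖ ^ 2))
    (hπd : ∀ s ∈ Ioo (0 : ℝ) 1, ∀ z : Config (N + 1) (Fin 3) T3,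
      HasDerivAt (fun r => ((hardSphereDomain (Torus.geometry (Fin 3)) (N + 1) (hsDiameter σ N)).indicator (tensorPow (N + 1) (localGibbsProfile (a r) (u r) (θ r)))) z) ((∑ i, sc s (z i)) * ((hardSphereDomain (Torus.geometry (Fin 3)) (N + 1) (hsDiameter σ N)).indicator (tensorPow (N + 1) (localGibbsProfile (a s) (u s) (θ s)))) z) s)
    (hprob : ∀ s ∈ Icc (0 : ℝ) 1, IsProbabilityMeasure (localGibbsLaw σ (a s) (u s) (θ s) N Φ))
    {w : T3 × V3 → ℝ} (hw : Continuous w) {Cw : ℝ} (hwb : ∀ y, |w y| ≤ Cw * (1 + ‖y.2‖ ^ 2))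
    (t : ℝ) {Ct C0 : ℝ} (hCt : 0 ≤ Ct) (hC0 : 0 ≤ C0)
    (hVt : ∀ s ∈ Icc (0 : ℝ) 1, ((N : ℝ≥0∞) + 1) *
      evariance (fun z => ∫ y, w y ∂(empiricalMeasure (Φ.flow t z)))
        (localGibbsLaw σ (a s) (u s) (θ s) N Φ) ≤ ENNReal.ofReal Ct)
    (hV0 : ∀ s ∈ Ioo (0 : ℝ) 1, ((N : ℝ≥0∞) + 1) *
      evariance (fun z => ∫ y, sc s y ∂(empiricalMeasure (Φ.flow 0 z)))
        (localGibbsLaw σ (a s) (u s) (θ s) N Φ) ≤ ENNReal.ofReal C0) :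
    ∀ s ∈ Icc (0 : ℝ) 1, ∀ s' ∈ Icc (0 : ℝ) 1,
      |(∫ z, (∫ y, w y ∂(empiricalMeasure (Φ.flow t z))) ∂(localGibbsLaw σ (a s) (u s) (θ s) N Φ)) -
        ∫ z, (∫ y, w y ∂(empiricalMeasure (Φ.flow t z))) ∂(localGibbsLaw σ (a s') (u s') (θ s') N Φ)|
        ≤ Real.sqrt Ct * Real.sqrt C0 * |s - s'| := by
  have hB0 : 0 < B := by linarith
  have hsub : Ioo (0 : ℝ) 1 ⊆ Icc 0 1 := Ioo_subset_Icc_self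
  have hpos0 : ∀ s ∈ Icc (0 : ℝ) 1, (∀ x, 0 ≤ a s x) ∧ ∀ x, 0 ≤ θ s x := fun s hs =>
    ⟨fun x => ((inv_pos.2 hB0).le.trans (hbd s hs x).1),
      fun x => ((inv_pos.2 hB0).le.trans (hbd s hs x).2.2.1)⟩
  set W : Config (N + 1) (Fin 3) T3 → ℝ := fun z => ∫ y, w y ∂(empiricalMeasure (Φ.flow t z)) with hW
  have hWm : Measurable W := measurable_integral_empiricalMeasure_flow Φ hw t
  have hWb := ae_abs_obs_le (σ := σ) (N := N) Φ hwb t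
  set m : ℝ → ℝ := fun s => ∫ z, W z ∂(localGibbsLaw σ (a s) (u s) (θ s) N Φ) with hm
  set L : ℝ := Real.sqrt Ct * Real.sqrt C0 with hL
  -- continuity of `m` on `[0,1]`
  have h1b : ∀ᵐ z ∂(volume : Measure (Config (N + 1) (Fin 3) T3)), z ∈ (hardSphereDomain (Torus.geometry (Fin 3)) (N + 1) (hsDiameter σ N)) →
      |(fun _ => (1 : ℝ)) z| ≤ 1 * (1 + 2 * configEnergy z) :=
    Eventually.of_forall fun z _ => by
      have := configEnergy_nonneg' z
      simp only [abs_one]; nlinarith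
  have hAc := continuousOn_integral_weight (σ := σ) (N := N) hB hcont hconts hbd hWm hWb
  have hZc := continuousOn_integral_weight (σ := σ) (N := N) hB hcont hconts hbd
    (measurable_const (a := (1 : ℝ))) h1b
  simp only [one_mul] at hZc
  have hmeq : ∀ s ∈ Icc (0 : ℝ) 1, m s =
      (∫ z, W z * ((hardSphereDomain (Torus.geometry (Fin 3)) (N + 1) (hsDiameter σ N)).indicator (tensorPow (N + 1) (localGibbsProfile (a s) (u s) (θ s)))) z) / ∫ z, ((hardSphereDomain (Torus.geometry (Fin 3)) (N + 1) (hsDiameter σ N)).indicator (tensorPow (N + 1) (localGibbsProfile (a s) (u s) (θ s)))) z := by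
    intro s hs
    rw [hm]
    simp only
    rw [integral_localGibbsLaw_eq Φ (hcont s hs).1 (hcont s hs).2.1 (hcont s hs).2.2
      (hpos0 s hs).1 (hpos0 s hs).2, div_eq_inv_mul]
    rfl
  have hZpos : ∀ s ∈ Icc (0 : ℝ) 1, 0 < ∫ z, ((hardSphereDomain (Torus.geometry (Fin 3)) (N + 1) (hsDiameter σ N)).indicator (tensorPow (N + 1) (localGibbsProfile (a s) (u s) (θ s)))) z := by
    intro s hs
    haveI := hprob s hs
    exact canonicalPartition_pos_of_isProbabilityMeasure Φ (hpos0 s hs).1 (hpos0 s hs).2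
  have hmc : ContinuousOn m (Icc 0 1) := by
    refine ContinuousOn.congr (hAc.div hZc fun s hs => (hZpos s hs).ne') fun s hs => ?_
    exact hmeq s hs
  -- differentiability on `(0,1)` with `|m'| ≤ L`
  have hderiv : ∀ s ∈ Ioo (0 : ℝ) 1, ∃ m' : ℝ, HasDerivAt m m' s ∧ |m'| ≤ L := by
    intro s hs
    have h := hasDerivAt_mean (σ := σ) (N := N) Φ hB hcont hbd hK0 hπc hπb hπd hprob hWm hWb hs
    refine ⟨_, h, ?_⟩
    haveI := hprob s (hsub hs)
    exact abs_sub_mul_le_sqrt Φ hWm (hπc s hs) hCt hC0 (hVt s (hsub hs)) (hV0 s hs)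
  have hdiff : DifferentiableOn ℝ m (interior (Icc (0 : ℝ) 1)) := by
    rw [interior_Icc]
    intro s hs
    obtain ⟨m', hm', -⟩ := hderiv s hs
    exact hm'.differentiableAt.differentiableWithinAt
  have hle : ∀ s ∈ interior (Icc (0 : ℝ) 1), deriv m s ≤ L := by
    rw [interior_Icc]
    intro s hs
    obtain ⟨m', hm', hb⟩ := hderiv s hs
    rw [hm'.deriv]
    exact (le_abs_self _).trans hb
  have hge : ∀ s ∈ interior (Icc (0 : ℝ) 1), -L ≤ deriv m s := by
    rw [interior_Icc]
    intro s hs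
    obtain ⟨m', hm', hb⟩ := hderiv s hs
    rw [hm'.deriv]
    exact neg_le_of_abs_le hb
  -- the mean value theorem on `[0,1]`
  have hmvt : ∀ x ∈ Icc (0 : ℝ) 1, ∀ y ∈ Icc (0 : ℝ) 1, x ≤ y → |m y - m x| ≤ L * (y - x) := by
    intro x hx y hy hxy
    have hup := (convex_Icc 0 1).image_sub_le_mul_sub_of_deriv_le hmc hdiff hle x hx y hy hxy
    have hlow := (convex_Icc 0 1).mul_sub_le_image_sub_of_le_deriv hmc hdiff hge x hx y hy hxy
    rw [abs_le]
    constructor <;> linarith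
  intro s hs s' hs'
  rcases le_total s s' with h | h
  · have := hmvt s hs s' hs' h
    rw [abs_sub_comm, abs_of_nonpos (by linarith : s - s' ≤ 0)]
    simpa [neg_sub] using this
  · have := hmvt s' hs' s hs h
    rw [abs_of_nonneg (by linarith : 0 ≤ s - s')]
    exact this

end Path

end Summit.AtomisticToContinuum.HydrodynamicLimit.Theorems.AmplitudeTransfer

end
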